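import Mathlib.RingTheory.Ideal.Maps
import Mathlib.RingTheory.Ideal.Operations
import Mathlib.Algebra.Order.Floor.Ring
import Mathlib.Algebra.Order.Floor.Semiring
import Mathlib.Data.Rat.Floor
import Mathlib.Algebra.GroupWithZero.NonZeroDivisors
import Mathlib.Tactic.Ring
import Mathlib.Tactic.Positivity
import Mathlib.Tactic.Linarith
import HarnessLib

/-!
# Crux `Steer` (stmt-ResolutionOfSingularities-16345), chain W4.1, β-LEAF (hK4′), K-β2♭ part (I): the REPRESENTATIVE-LEVEL
# letter laws — PUSH-FORWARD of the projected-polygon threshold ideals along the chart substitution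
# (CJS LNM 2270 Lemma 10.3 (10.5) / 12.1 (3) / 12.2 (3) in ideal form; Theses-free, def-free research support)

OURS (campaign `res-hironaka`, rung L ★L-G4, slot W4.1; statements about the route's own objects; they replace the
role of no printed item and are NOT statements of the manuscript under review [claim: Hironaka2017, status:
under-review]; AI review is weaker than expert review). Seat res-D-pv-003 (gen 6), K-β2♭ letter-law kernel owner
(res-L0-w41-plan-1 RULINGS 140/143/148a). This is cut (I) of my 13:58Z note: NO gauge, NO sup — for ONE representative
`f` and its transform `f₁` the polygon thresholds push forward along the substitution homomorphism `φ`. The star-level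
laws `XLetterLawHat`/`YLetterLawHat` (res-L0-w41-idea-1 v18, twisted gauge per res-L0-w41-tri-2 TRIAGE v18) are
(I) + (II) preparedness transfer + (III) K-β1♭ attainment; (II)/(III) are NOT here.

## Currency (def-free; matches idea-1's `AlphaGe` / `DeltaGe` / `BetaGe` by `unfold`, see §4)

The projected polygon `Δ(f ; (z,w) ; (x,y))` of CJS Def. 11.1 is read through MONOMIAL-REGION IDEALS of the regular
parameters: for a region `R : ℕ → ℕ → ℕ → Prop` (arguments `n = d − i − j`, `a`, `b`),

  `Poly(R) := (z, w)^d + Σ_{i+j<d} Σ_{R (d−i−j) a b} (x^a y^b z^i w^j)`.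

`α ≥ ρ` is the region `⌈ρ n⌉ ≤ a`, `δ ≥ ρ` is `⌈ρ n⌉ ≤ a + b`, «`β ≥ ρ` on the column `α`» is
`⌊α n⌋ + 1 ≤ a ∨ (⌈α n⌉ ≤ a ∧ ⌈ρ n⌉ ≤ b)`, the `δ`-face threshold «`γ⁻ ≥ ρ`» is `⌊δ n⌋ + 1 ≤ a + b ∨ (a + b = δ n ∧ ρ n ≤ b)`.

## The substitution (res-L0-w41-strat-2 / idea-1 §5♭ «Cohen coordinates», abstractly)

`φ : S →+* S₁` with `φ y = φ x · (c₁ + v₁)`, `φ z = φ x · z₁`, `φ w = φ x · w₁`, `φ f = (φ x)^d · f₁` (x-chart letter at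
`(1 : c)`, the shear absorbed in the constant `c₁`; `c₁ = 0` for the `β`-law) resp. `φ x = φ y · x₁`, `φ z = φ y · z₁`,
`φ w = φ y · w₁`, `φ f = (φ y)^d · f₁` (y-chart letter), and `φ x` resp. `φ y` a non-zero-divisor of `S₁` (a domain in
the use). EXPONENT MAPS (CJS Ψ): x-letter `(a, b) ↦ (a + b − n, b)`, y-letter `(a, b) ↦ (a, a + b − n)` — the
monomial `x^a y^b z^i w^j` becomes `(φ x)^(a+b+i+j) (c₁+v₁)^b z₁^i w₁^j = (φ x)^d · (φ x)^(a+b−n) (…)`.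

## Contents

* §1 `mem_of_map_le_span_pow_mul`: cancelling `(φ x)^d`.
* §2 MASTER LEMMAS `poly_push_x` (x-letter, any `c₁`, regions in `a` only downstairs or `c₁ = 0`), `poly_push_x0`
  (`c₁ = 0`, regions in `(a, b)`), `poly_push_y`.
* §3 THE LAWS at representative level: `alpha_x_letter` («`δ ≥ ρ ⇒ α₁ ≥ ρ − 1`», any `c₁`), `beta_x_letter`
  («`γ⁻`-face threshold ⇒ `β₁ ≥ ρ` on the column `δ − 1`», `c₁ = 0`), `alpha_y_letter` («`α ≥ ρ ⇒ α₁ ≥ ρ`»),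
  `beta_y_letter` («column `(α, β)` ⇒ `β₁ ≥ α + β − 1` on the column `α`»); every law carries the ORDER clause
  `n ≤ a + b` in its region (all stages have `ord f = d`; CJS's `δ > 1`).
* (part 2, `…BetaLetterPushIdent.lean`) the identifications of idea-1's threshold ideals with region ideals.

No Theses file is imported; nothing here is a route item or a registration. [cite: CossartJannsenSaito2020, Lemma 10.3]
[cite: CossartJannsenSaito2020, Lemma 12.1] [cite: CossartJannsenSaito2020, Lemma 12.2]
-/

noncomputable section

-- `Summit.<S>.<S>.…` duplicates the summit name by design (single-problem summit).
set_option linter.dupNamespace false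

open nonZeroDivisors

namespace Summit.ResolutionOfSingularities.ResolutionOfSingularities.Theorems.SwitchingDichotomy.BetaLetter

variable {S S₁ : Type*} [CommRing S] [CommRing S₁]

/-! ## §1 Cancelling the exceptional factor -/

/-- If `φ f = u^d · f₁`, `u` is a non-zero-divisor, `f ∈ I` and `φ(I) ⊆ (u^d) · J`, then `f₁ ∈ J`. [folklore] -/
theorem mem_of_map_le_span_pow_mul (φ : S →+* S₁) {u : S₁} (hu : u ∈ S₁⁰) {d : ℕ} {f : S} {f₁ : S₁}
    (hf : φ f = u ^ d * f₁) {I : Ideal S} {J : Ideal S₁} (hI : f ∈ I) (hle : I.map φ ≤ Ideal.span {u ^ d} * J) :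
    f₁ ∈ J := by
  have h := hle (Ideal.mem_map_of_mem φ hI)
  rw [hf] at h
  obtain ⟨g, hg, hug⟩ := Ideal.mem_span_singleton_mul.mp h
  have hud : u ^ d ∈ S₁⁰ := pow_mem hu d
  have : g = f₁ := by
    have h0 : (g - f₁) * u ^ d = 0 := by rw [sub_mul, mul_comm g, mul_comm f₁, hug, sub_self]
    exact sub_eq_zero.mp ((mem_nonZeroDivisors_iff.mp hud).2 _ h0)
  rw [← this]
  exact hg

/-- `(u·z₁, u·w₁)^d ⊆ (u^d) · (z₁, w₁)^d`. [folklore] -/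
theorem span_pair_mul_pow_le (u z₁ w₁ : S₁) (d : ℕ) :
    Ideal.span ({u * z₁, u * w₁} : Set S₁) ^ d ≤ Ideal.span {u ^ d} * Ideal.span {z₁, w₁} ^ d := by
  have h : Ideal.span ({u * z₁, u * w₁} : Set S₁) ≤ Ideal.span {u} * Ideal.span {z₁, w₁} := by
    rw [Ideal.span_le]
    rintro _ (rfl | rfl)
    · exact Ideal.mul_mem_mul (Ideal.mem_span_singleton_self u) (Ideal.subset_span (by simp))
    · exact Ideal.mul_mem_mul (Ideal.mem_span_singleton_self u) (Ideal.subset_span (by simp))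
  refine (Ideal.pow_right_mono h d).trans ?_
  rw [mul_pow, Ideal.span_singleton_pow]

/-! ## §2 Master lemmas: pushing a monomial-region ideal forward along the substitution -/

/-- **x-letter, `c₁ = 0` (pure x-chart after the shear).** If every monomial region `R n a b` upstairs has `n ≤ a + b`
(order `d`) and maps to `R' n (a + b − n) b` (CJS's `Ψ(a, b) = (a + b − 1, b)` in normalised coordinates), then
`f ∈ Poly(R)` implies `f₁ ∈ Poly₁(R')` for the transform `φ f = (φ x)^d f₁` under `φ y = φ x · v₁`, `φ z = φ x · z₁`,
`φ w = φ x · w₁`. [cite: CossartJannsenSaito2020, Lemma 10.3] -/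
theorem poly_push_x0 (φ : S →+* S₁) {x y z w f : S} {v₁ z₁ w₁ f₁ : S₁} {d : ℕ}
    (hx : φ x ∈ S₁⁰) (hy : φ y = φ x * v₁) (hz : φ z = φ x * z₁) (hw : φ w = φ x * w₁)
    (hf : φ f = φ x ^ d * f₁) (R R' : ℕ → ℕ → ℕ → Prop)
    (hRR' : ∀ n a b, R n a b → n ≤ a + b ∧ R' n (a + b - n) b)
    (hmem : f ∈ Ideal.span {z, w} ^ d ⊔ ⨆ (i : ℕ) (j : ℕ) (_ : i + j < d) (a : ℕ) (b : ℕ) (_ : R (d - i - j) a b),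
      Ideal.span {x ^ a * y ^ b * z ^ i * w ^ j}) :
    f₁ ∈ Ideal.span {z₁, w₁} ^ d ⊔ ⨆ (i : ℕ) (j : ℕ) (_ : i + j < d) (a : ℕ) (b : ℕ) (_ : R' (d - i - j) a b),
      Ideal.span {φ x ^ a * v₁ ^ b * z₁ ^ i * w₁ ^ j} := by
  set u := φ x with hu
  set J : Ideal S₁ := Ideal.span {z₁, w₁} ^ d ⊔ ⨆ (i : ℕ) (j : ℕ) (_ : i + j < d) (a : ℕ) (b : ℕ)
    (_ : R' (d - i - j) a b), Ideal.span {u ^ a * v₁ ^ b * z₁ ^ i * w₁ ^ j} with hJ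
  refine mem_of_map_le_span_pow_mul φ hx hf hmem ?_
  rw [Ideal.map_sup]
  refine sup_le ?_ ?_
  · -- the cone part `(z, w)^d`
    rw [Ideal.map_pow, Ideal.map_span, Set.image_pair, hz, hw]
    exact (span_pair_mul_pow_le u z₁ w₁ d).trans (Ideal.mul_mono_right le_sup_left)
  · simp only [Ideal.map_iSup, Ideal.map_span, Set.image_singleton, map_mul, map_pow, hy, hz, hw]
    refine iSup_le fun i => iSup_le fun j => iSup_le fun hij => iSup_le fun a => iSup_le fun b => iSup_le fun hR => ?_
    obtain ⟨hn, hR'⟩ := hRR' (d - i - j) a b hR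
    -- the transformed monomial is `u^d · (u^(a+b−n) v₁^b z₁^i w₁^j)`
    have hexp : a + (b + (i + j)) = d + (a + b - (d - i - j)) := by omega
    have hmono : u ^ a * (u * v₁) ^ b * (u * z₁) ^ i * (u * w₁) ^ j =
        u ^ d * (u ^ (a + b - (d - i - j)) * v₁ ^ b * z₁ ^ i * w₁ ^ j) := by
      have : u ^ a * (u * v₁) ^ b * (u * z₁) ^ i * (u * w₁) ^ j =
          u ^ (a + (b + (i + j))) * (v₁ ^ b * z₁ ^ i * w₁ ^ j) := by ring
      rw [this, hexp, pow_add]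
      ring
    rw [hmono, ← Ideal.span_singleton_mul_span_singleton]
    refine Ideal.mul_mono_right ((Ideal.span_singleton_le_iff_mem _).mpr (Ideal.mem_sup_right ?_))
    refine Submodule.mem_iSup_of_mem i (Submodule.mem_iSup_of_mem j (Submodule.mem_iSup_of_mem hij
      (Submodule.mem_iSup_of_mem (a + b - (d - i - j)) (Submodule.mem_iSup_of_mem b
        (Submodule.mem_iSup_of_mem hR' (Ideal.mem_span_singleton_self _))))))

/-- **x-letter at `(1 : c)` with the shear ABSORBED in the constant `c₁`** (`φ y = φ x · (c₁ + v₁)`): regions that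
constrain only the new ABSCISSA push forward (`α`-laws; the `β`-information of a sheared letter is read after
`BetaShear.betaThreshold_shear`, i.e. with `c₁ = 0`). [cite: CossartJannsenSaito2020, Lemma 10.3] -/
theorem poly_push_x (φ : S →+* S₁) {x y z w f : S} {c₁ v₁ z₁ w₁ f₁ : S₁} {d : ℕ}
    (hx : φ x ∈ S₁⁰) (hy : φ y = φ x * (c₁ + v₁)) (hz : φ z = φ x * z₁) (hw : φ w = φ x * w₁)
    (hf : φ f = φ x ^ d * f₁) (R : ℕ → ℕ → ℕ → Prop) (R' : ℕ → ℕ → Prop)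
    (hRR' : ∀ n a b, R n a b → n ≤ a + b ∧ R' n (a + b - n))
    (hmem : f ∈ Ideal.span {z, w} ^ d ⊔ ⨆ (i : ℕ) (j : ℕ) (_ : i + j < d) (a : ℕ) (b : ℕ) (_ : R (d - i - j) a b),
      Ideal.span {x ^ a * y ^ b * z ^ i * w ^ j}) :
    f₁ ∈ Ideal.span {z₁, w₁} ^ d ⊔ ⨆ (i : ℕ) (j : ℕ) (_ : i + j < d) (a : ℕ) (_ : R' (d - i - j) a),
      Ideal.span {φ x ^ a * z₁ ^ i * w₁ ^ j} := by
  set u := φ x with hu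
  set e := c₁ + v₁ with he
  refine mem_of_map_le_span_pow_mul φ hx hf hmem ?_
  rw [Ideal.map_sup]
  refine sup_le ?_ ?_
  · rw [Ideal.map_pow, Ideal.map_span, Set.image_pair, hz, hw]
    exact (span_pair_mul_pow_le u z₁ w₁ d).trans (Ideal.mul_mono_right le_sup_left)
  · simp only [Ideal.map_iSup, Ideal.map_span, Set.image_singleton, map_mul, map_pow, hy, hz, hw]
    refine iSup_le fun i => iSup_le fun j => iSup_le fun hij => iSup_le fun a => iSup_le fun b => iSup_le fun hR => ?_
    obtain ⟨hn, hR'⟩ := hRR' (d - i - j) a b hR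
    have hexp : a + (b + (i + j)) = d + (a + b - (d - i - j)) := by omega
    have hmono : u ^ a * (u * e) ^ b * (u * z₁) ^ i * (u * w₁) ^ j =
        u ^ d * (u ^ (a + b - (d - i - j)) * z₁ ^ i * w₁ ^ j) * e ^ b := by
      have : u ^ a * (u * e) ^ b * (u * z₁) ^ i * (u * w₁) ^ j =
          u ^ (a + (b + (i + j))) * (z₁ ^ i * w₁ ^ j) * e ^ b := by ring
      rw [this, hexp, pow_add]
      ring
    rw [hmono]
    refine (Ideal.span_singleton_le_iff_mem _).mpr (Ideal.mul_mem_right _ _ ?_)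
    refine Ideal.mul_mem_mul (Ideal.mem_span_singleton_self _) (Ideal.mem_sup_right ?_)
    refine Submodule.mem_iSup_of_mem i (Submodule.mem_iSup_of_mem j (Submodule.mem_iSup_of_mem hij
      (Submodule.mem_iSup_of_mem (a + b - (d - i - j))
        (Submodule.mem_iSup_of_mem hR' (Ideal.mem_span_singleton_self _)))))

/-- **y-letter** (the point `(0 : 1)`; `φ x = φ y · x₁`, `φ z = φ y · z₁`, `φ w = φ y · w₁`, `φ f = (φ y)^d f₁`): regions with
`n ≤ a + b` push forward along CJS's `Ψ(a, b) = (a, a + b − 1)`, i.e. `(a, b) ↦ (a, a + b − n)`.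
[cite: CossartJannsenSaito2020, Lemma 12.2] -/
theorem poly_push_y (φ : S →+* S₁) {x y z w f : S} {x₁ z₁ w₁ f₁ : S₁} {d : ℕ}
    (hy : φ y ∈ S₁⁰) (hx : φ x = φ y * x₁) (hz : φ z = φ y * z₁) (hw : φ w = φ y * w₁)
    (hf : φ f = φ y ^ d * f₁) (R R' : ℕ → ℕ → ℕ → Prop)
    (hRR' : ∀ n a b, R n a b → n ≤ a + b ∧ R' n a (a + b - n))
    (hmem : f ∈ Ideal.span {z, w} ^ d ⊔ ⨆ (i : ℕ) (j : ℕ) (_ : i + j < d) (a : ℕ) (b : ℕ) (_ : R (d - i - j) a b),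
      Ideal.span {x ^ a * y ^ b * z ^ i * w ^ j}) :
    f₁ ∈ Ideal.span {z₁, w₁} ^ d ⊔ ⨆ (i : ℕ) (j : ℕ) (_ : i + j < d) (a : ℕ) (b : ℕ) (_ : R' (d - i - j) a b),
      Ideal.span {x₁ ^ a * φ y ^ b * z₁ ^ i * w₁ ^ j} := by
  set t := φ y with ht
  refine mem_of_map_le_span_pow_mul φ hy hf hmem ?_
  rw [Ideal.map_sup]
  refine sup_le ?_ ?_
  · rw [Ideal.map_pow, Ideal.map_span, Set.image_pair, hz, hw]
    exact (span_pair_mul_pow_le t z₁ w₁ d).trans (Ideal.mul_mono_right le_sup_left)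
  · simp only [Ideal.map_iSup, Ideal.map_span, Set.image_singleton, map_mul, map_pow, hx, hz, hw]
    refine iSup_le fun i => iSup_le fun j => iSup_le fun hij => iSup_le fun a => iSup_le fun b => iSup_le fun hR => ?_
    obtain ⟨hn, hR'⟩ := hRR' (d - i - j) a b hR
    have hexp : b + (a + (i + j)) = d + (a + b - (d - i - j)) := by omega
    have hmono : (t * x₁) ^ a * t ^ b * (t * z₁) ^ i * (t * w₁) ^ j =
        t ^ d * (x₁ ^ a * t ^ (a + b - (d - i - j)) * z₁ ^ i * w₁ ^ j) := by
      have : (t * x₁) ^ a * t ^ b * (t * z₁) ^ i * (t * w₁) ^ j =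
          t ^ (b + (a + (i + j))) * (x₁ ^ a * z₁ ^ i * w₁ ^ j) := by ring
      rw [this, hexp, pow_add]
      ring
    rw [hmono, ← Ideal.span_singleton_mul_span_singleton]
    refine Ideal.mul_mono_right ((Ideal.span_singleton_le_iff_mem _).mpr (Ideal.mem_sup_right ?_))
    refine Submodule.mem_iSup_of_mem i (Submodule.mem_iSup_of_mem j (Submodule.mem_iSup_of_mem hij
      (Submodule.mem_iSup_of_mem a (Submodule.mem_iSup_of_mem (a + b - (d - i - j))
        (Submodule.mem_iSup_of_mem hR' (Ideal.mem_span_singleton_self _))))))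

/-! ## §3 The four representative-level letter laws (regions of CJS 12.1 (3) / 12.2 (3)) -/

section Laws

/-- Ceiling arithmetic: `⌈ρ n⌉ = n + ⌈(ρ − 1) n⌉` for `ρ ≥ 1`. [folklore] -/
theorem ceil_mul_eq (ρ : ℚ) (n : ℕ) (h : 1 ≤ ρ) : ⌈ρ * n⌉₊ = n + ⌈(ρ - 1) * n⌉₊ := by
  have h0 : 0 ≤ (ρ - 1) * n := by positivity
  have : ρ * n = (ρ - 1) * n + n := by ring
  rw [this, Nat.ceil_add_natCast h0]
  ring

/-- Floor arithmetic: `⌊δ n⌋ = n + ⌊(δ − 1) n⌋` for `δ ≥ 1`. [folklore] -/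
theorem floor_mul_eq (δ : ℚ) (n : ℕ) (h : 1 ≤ δ) : ⌊δ * n⌋₊ = n + ⌊(δ - 1) * n⌋₊ := by
  have h0 : 0 ≤ (δ - 1) * n := by positivity
  have : δ * n = (δ - 1) * n + n := by ring
  rw [this, Nat.floor_add_natCast h0]
  ring

/-- **X-letter, `α`-law at representative level («`δ ≥ ρ ⇒ α₁ ≥ ρ − 1`», CJS 12.1 (3) `α′ = δ − 1`, the push-forward
half), ANY shear constant `c₁`.** [cite: CossartJannsenSaito2020, Lemma 12.1] -/
theorem alpha_x_letter (φ : S →+* S₁) {x y z w f : S} {c₁ v₁ z₁ w₁ f₁ : S₁} {d : ℕ}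
    (hx : φ x ∈ S₁⁰) (hy : φ y = φ x * (c₁ + v₁)) (hz : φ z = φ x * z₁) (hw : φ w = φ x * w₁)
    (hf : φ f = φ x ^ d * f₁) {ρ : ℚ} (hρ : 1 ≤ ρ)
    (hmem : f ∈ Ideal.span {z, w} ^ d ⊔ ⨆ (i : ℕ) (j : ℕ) (_ : i + j < d) (a : ℕ) (b : ℕ)
      (_ : ⌈ρ * ((d - i - j : ℕ) : ℚ)⌉₊ ≤ a + b), Ideal.span {x ^ a * y ^ b * z ^ i * w ^ j}) :
    f₁ ∈ Ideal.span {z₁, w₁} ^ d ⊔ ⨆ (i : ℕ) (j : ℕ) (_ : i + j < d) (a : ℕ)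
      (_ : ⌈(ρ - 1) * ((d - i - j : ℕ) : ℚ)⌉₊ ≤ a), Ideal.span {φ x ^ a * z₁ ^ i * w₁ ^ j} := by
  refine poly_push_x φ hx hy hz hw hf (fun n a b => ⌈ρ * (n : ℚ)⌉₊ ≤ a + b)
    (fun n a => ⌈(ρ - 1) * (n : ℚ)⌉₊ ≤ a) (fun n a b h => ?_) hmem
  rw [ceil_mul_eq ρ n hρ] at h
  constructor <;> omega

/-- **X-letter, `β`-law at representative level, `c₁ = 0`** («`γ⁻ ≥ ρ` on the `δ`-face upstairs ⇒ `β₁ ≥ ρ` on the column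
`α₁ = δ − 1` downstairs», CJS 12.1 (3) `β′ = γ⁻`, the push-forward half): monomials strictly inside the half-plane
`a + b ≥ ⌊δ n⌋ + 1` land strictly right of the new column; monomials ON the face (`a + b = δ n`) with `b ≥ ρ n` land on
the new column above `ρ`. [cite: CossartJannsenSaito2020, Lemma 12.1] -/
theorem beta_x_letter (φ : S →+* S₁) {x y z w f : S} {v₁ z₁ w₁ f₁ : S₁} {d : ℕ}
    (hx : φ x ∈ S₁⁰) (hy : φ y = φ x * v₁) (hz : φ z = φ x * z₁) (hw : φ w = φ x * w₁)
    (hf : φ f = φ x ^ d * f₁) {δ ρ : ℚ} (hδ : 1 ≤ δ)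
    (hmem : f ∈ Ideal.span {z, w} ^ d ⊔ ⨆ (i : ℕ) (j : ℕ) (_ : i + j < d) (a : ℕ) (b : ℕ)
      (_ : ⌊δ * ((d - i - j : ℕ) : ℚ)⌋₊ + 1 ≤ a + b ∨
        (((a + b : ℕ) : ℚ) = δ * ((d - i - j : ℕ) : ℚ) ∧ ρ * ((d - i - j : ℕ) : ℚ) ≤ b)),
      Ideal.span {x ^ a * y ^ b * z ^ i * w ^ j}) :
    f₁ ∈ Ideal.span {z₁, w₁} ^ d ⊔ ⨆ (i : ℕ) (j : ℕ) (_ : i + j < d) (a : ℕ) (b : ℕ)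
      (_ : ⌊(δ - 1) * ((d - i - j : ℕ) : ℚ)⌋₊ + 1 ≤ a ∨
        (⌈(δ - 1) * ((d - i - j : ℕ) : ℚ)⌉₊ ≤ a ∧ ⌈ρ * ((d - i - j : ℕ) : ℚ)⌉₊ ≤ b)),
      Ideal.span {φ x ^ a * v₁ ^ b * z₁ ^ i * w₁ ^ j} := by
  refine poly_push_x0 φ hx hy hz hw hf
    (fun n a b => ⌊δ * (n : ℚ)⌋₊ + 1 ≤ a + b ∨ (((a + b : ℕ) : ℚ) = δ * (n : ℚ) ∧ ρ * (n : ℚ) ≤ b))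
    (fun n a b => ⌊(δ - 1) * (n : ℚ)⌋₊ + 1 ≤ a ∨ (⌈(δ - 1) * (n : ℚ)⌉₊ ≤ a ∧ ⌈ρ * (n : ℚ)⌉₊ ≤ b))
    (fun n a b h => ?_) hmem
  have hn1 : (n : ℚ) ≤ δ * n := by nlinarith [(Nat.cast_nonneg n : (0 : ℚ) ≤ n)]
  rcases h with h | ⟨hab, hb⟩
  · rw [floor_mul_eq δ n hδ] at h
    refine ⟨by omega, Or.inl (by omega)⟩
  · -- on the face: `a + b = δ n` is an integer, `(δ − 1) n = a + b − n`
    have hle : n ≤ a + b := by exact_mod_cast (hn1.trans_eq hab.symm)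
    have hceil : ⌈(δ - 1) * (n : ℚ)⌉₊ = a + b - n := by
      have : (δ - 1) * (n : ℚ) = ((a + b - n : ℕ) : ℚ) := by
        rw [Nat.cast_sub hle]
        push_cast at hab ⊢
        linarith
      rw [this, Nat.ceil_natCast]
    have hb' : ⌈ρ * (n : ℚ)⌉₊ ≤ b := Nat.ceil_le.mpr hb
    exact ⟨hle, Or.inr ⟨by omega, hb'⟩⟩

/-- **Y-letter, `α`-law at representative level** («`α ≥ ρ ⇒ α₁ ≥ ρ`», CJS 12.2 (3) `α′ = α`, push-forward half); the
region carries the order clause `n ≤ a + b` (all stages have `ord f = d`). [cite: CossartJannsenSaito2020, Lemma 12.2] -/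
theorem alpha_y_letter (φ : S →+* S₁) {x y z w f : S} {x₁ z₁ w₁ f₁ : S₁} {d : ℕ}
    (hy : φ y ∈ S₁⁰) (hx : φ x = φ y * x₁) (hz : φ z = φ y * z₁) (hw : φ w = φ y * w₁)
    (hf : φ f = φ y ^ d * f₁) {ρ : ℚ}
    (hmem : f ∈ Ideal.span {z, w} ^ d ⊔ ⨆ (i : ℕ) (j : ℕ) (_ : i + j < d) (a : ℕ) (b : ℕ)
      (_ : d - i - j ≤ a + b ∧ ⌈ρ * ((d - i - j : ℕ) : ℚ)⌉₊ ≤ a), Ideal.span {x ^ a * y ^ b * z ^ i * w ^ j}) :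
    f₁ ∈ Ideal.span {z₁, w₁} ^ d ⊔ ⨆ (i : ℕ) (j : ℕ) (_ : i + j < d) (a : ℕ) (b : ℕ)
      (_ : ⌈ρ * ((d - i - j : ℕ) : ℚ)⌉₊ ≤ a), Ideal.span {x₁ ^ a * φ y ^ b * z₁ ^ i * w₁ ^ j} :=
  poly_push_y φ hy hx hz hw hf (fun n a b => n ≤ a + b ∧ ⌈ρ * (n : ℚ)⌉₊ ≤ a)
    (fun n a _ => ⌈ρ * (n : ℚ)⌉₊ ≤ a) (fun _ _ _ h => ⟨h.1, h.2⟩) hmem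

/-- **Y-letter, `β`-law at representative level** («column `(α, β)` upstairs ⇒ `β₁ ≥ α + β − 1` on the column `α`
downstairs», CJS 12.2 (3), push-forward half): the new ordinate of `x^a y^b` is `a + b − n`; on the column (`a = ⌈α n⌉`,
integral) `b ≥ ⌈β n⌉` gives `a + b − n ≥ ⌈(α + β − 1) n⌉`. [cite: CossartJannsenSaito2020, Lemma 12.2] -/
theorem beta_y_letter (φ : S →+* S₁) {x y z w f : S} {x₁ z₁ w₁ f₁ : S₁} {d : ℕ}
    (hy : φ y ∈ S₁⁰) (hx : φ x = φ y * x₁) (hz : φ z = φ y * z₁) (hw : φ w = φ y * w₁)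
    (hf : φ f = φ y ^ d * f₁) {α β : ℚ}
    (hmem : f ∈ Ideal.span {z, w} ^ d ⊔ ⨆ (i : ℕ) (j : ℕ) (_ : i + j < d) (a : ℕ) (b : ℕ)
      (_ : d - i - j ≤ a + b ∧ (⌊α * ((d - i - j : ℕ) : ℚ)⌋₊ + 1 ≤ a ∨
        (⌈α * ((d - i - j : ℕ) : ℚ)⌉₊ ≤ a ∧ ⌈β * ((d - i - j : ℕ) : ℚ)⌉₊ ≤ b))),
      Ideal.span {x ^ a * y ^ b * z ^ i * w ^ j}) :
    f₁ ∈ Ideal.span {z₁, w₁} ^ d ⊔ ⨆ (i : ℕ) (j : ℕ) (_ : i + j < d) (a : ℕ) (b : ℕ)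
      (_ : ⌊α * ((d - i - j : ℕ) : ℚ)⌋₊ + 1 ≤ a ∨
        (⌈α * ((d - i - j : ℕ) : ℚ)⌉₊ ≤ a ∧ ⌈(α + β - 1) * ((d - i - j : ℕ) : ℚ)⌉₊ ≤ b)),
      Ideal.span {x₁ ^ a * φ y ^ b * z₁ ^ i * w₁ ^ j} := by
  refine poly_push_y φ hy hx hz hw hf
    (fun n a b => n ≤ a + b ∧ (⌊α * (n : ℚ)⌋₊ + 1 ≤ a ∨ (⌈α * (n : ℚ)⌉₊ ≤ a ∧ ⌈β * (n : ℚ)⌉₊ ≤ b)))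
    (fun n a b => ⌊α * (n : ℚ)⌋₊ + 1 ≤ a ∨ (⌈α * (n : ℚ)⌉₊ ≤ a ∧ ⌈(α + β - 1) * (n : ℚ)⌉₊ ≤ b))
    (fun n a b h => ?_) hmem
  obtain ⟨hn, h⟩ := h
  refine ⟨hn, ?_⟩
  rcases h with h | ⟨ha, hb⟩
  · exact Or.inl h
  · by_cases hfl : ⌊α * (n : ℚ)⌋₊ + 1 ≤ a
    · exact Or.inl hfl
    · right
      refine ⟨ha, ?_⟩
      -- `a + b − n ≥ ⌈α n⌉ + ⌈β n⌉ − n ≥ ⌈(α + β − 1) n⌉` (or the ceiling is `0`)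
      have key : ⌈(α + β - 1) * (n : ℚ)⌉₊ + n ≤ a + b := by
        by_cases hneg : (α + β - 1) * (n : ℚ) ≤ 0
        · rw [Nat.ceil_eq_zero.mpr hneg, zero_add]
          exact hn
        · push Not at hneg
          have e : (α + β - 1) * (n : ℚ) + n = α * n + β * n := by ring
          have h1 : ⌈(α + β - 1) * (n : ℚ) + n⌉₊ = ⌈(α + β - 1) * (n : ℚ)⌉₊ + n :=
            Nat.ceil_add_natCast hneg.le n
          rw [← h1, e]
          exact (Nat.ceil_add_le _ _).trans (add_le_add ha hb)
      omega

end Laws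

end Summit.ResolutionOfSingularities.ResolutionOfSingularities.Theorems.SwitchingDichotomy.BetaLetter

end
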